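import Summits.QuantumFields.YangMills.Theorems.BalabanLadderIRTwistedSlabNoFlat
import HarnessLib

/-!
# Classical vacua of the twisted slab: the long and temporal Polyakov holonomies are PINNED TO THE CENTRE

HELPER toward stub **T1** `TwistedSlabAnchor` (LINE `twisted-slab-continuity`, crux `IRcof` stmt-QuantumFields-26930, census row 43; LEAD prover
ym-ir-line-tsc-p1; `--supports` the crux, `--as helper`).  Positive counterpart of `…NoFlat` (same six-slice computation, conclusion kept):
the located MECHANISM of T1 at the classical level — «for an ISOLATING twist the twist-eating flat connection pins the residual holonomies
`P₂, P₃` to the (finite) centre: no flat direction, no toron» (line card; 't Hooft 1979 §3; van Baal 1982; González-Arroyo 1998 §4.2).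

WHAT IS PROVED (ANY group `G`, any `Fin` box `(m₀+1)×(m₁+1)×(m₂+1)×(m₃+1)`, central `zM, zE`):
* ★ `twistedFlat_holonomy_relations` — if EVERY plaquette of the slab twist `slabTwist zM zE` is trivial (`w_x · U_p(x) = 1`), the four based
  Polyakov holonomies `H_μ` through the origin satisfy `H₁H₀H₁⁻¹H₀⁻¹ = zM`, `H₃H₂H₃⁻¹H₂⁻¹ = zE`, and
  `H₂H₀H₂⁻¹H₀⁻¹ = H₃H₀H₃⁻¹H₀⁻¹ = H₂H₁H₂⁻¹H₁⁻¹ = H₃H₁H₃⁻¹H₁⁻¹ = 1`;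
* ★ `twistedFlat_holonomies_central` — under the isolation hypothesis «elements commuting with a `zM`-eating pair are central» (`SU(N)`, `zM`
  generating: `centralizer_central_of_suCenter`), `H₂` and `H₃` are CENTRAL, hence `zE = H₃H₂H₃⁻¹H₂⁻¹ = 1`: the classical vacua of the
  magnetically twisted slab (`zE = 1`) have centre-valued long ∕ temporal holonomies — together with the uniqueness of twist-eating pairs
  (`HasIsolatingTwist`, clause 2) the holonomy data of a vacuum ranges over a FINITE set modulo conjugation; `…_specialUnitary`: the `SU(N)` reading.
NOT here (honest): the gauge-theoretic half «holonomies determine the configuration modulo gauge» (Fin-box axial gauge; the symmetric-torus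
version is the tree's `isTwistedFlat_iff_exists_gaugeTransform_eaterConfig`), and anything at `β < ∞`.

HONEST FRAMING: lattice group algebra on one box; nothing here bears on `IRcof`, `IR`, or the Yang–Mills mass gap (Clay: NOT proved);
R4 = `BalabanLadder.UV` only.
-/

set_option autoImplicit false

open Literature.MathematicalPhysics.QuantumFieldTheory
open Fin.NatCast

namespace Summit.QuantumFields.YangMills.Cruxes.IRcof.TwistedSlab

section Slab

variable {G : Type*} [Group G] {m₀ m₁ m₂ m₃ : ℕ}

/-- Coordinates of a site given by natural-number casts (all sides `m_i + 1 ≥ 1`). [folklore] -/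
private theorem fh_coord_cast (i₀ i₁ i₂ i₃ : ℕ) :
    finTorusSiteCoord (((i₀ : Fin (m₀ + 1)), (i₁ : Fin (m₁ + 1)), (i₂ : Fin (m₂ + 1)), (i₃ : Fin (m₃ + 1))) :
        FinTorusSite (m₀ + 1) (m₁ + 1) (m₂ + 1) (m₃ + 1)) =
      ![i₀ % (m₀ + 1), i₁ % (m₁ + 1), i₂ % (m₂ + 1), i₃ % (m₃ + 1)] := by
  unfold finTorusSiteCoord
  simp

/-- The four shifts of a cast site: `+1` on the shifted coordinate. [folklore] -/
private theorem fh_shift_cast (i₀ i₁ i₂ i₃ : ℕ) :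
    FinTorusSite.shift ((((i₀ : Fin (m₀ + 1)), (i₁ : Fin (m₁ + 1)), (i₂ : Fin (m₂ + 1)), (i₃ : Fin (m₃ + 1))) :
        FinTorusSite (m₀ + 1) (m₁ + 1) (m₂ + 1) (m₃ + 1))) 0 =
      (((i₀ + 1 : ℕ) : Fin (m₀ + 1)), (i₁ : Fin (m₁ + 1)), (i₂ : Fin (m₂ + 1)), (i₃ : Fin (m₃ + 1))) ∧
    FinTorusSite.shift ((((i₀ : Fin (m₀ + 1)), (i₁ : Fin (m₁ + 1)), (i₂ : Fin (m₂ + 1)), (i₃ : Fin (m₃ + 1))) :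
        FinTorusSite (m₀ + 1) (m₁ + 1) (m₂ + 1) (m₃ + 1))) 1 =
      ((i₀ : Fin (m₀ + 1)), ((i₁ + 1 : ℕ) : Fin (m₁ + 1)), (i₂ : Fin (m₂ + 1)), (i₃ : Fin (m₃ + 1))) ∧
    FinTorusSite.shift ((((i₀ : Fin (m₀ + 1)), (i₁ : Fin (m₁ + 1)), (i₂ : Fin (m₂ + 1)), (i₃ : Fin (m₃ + 1))) :
        FinTorusSite (m₀ + 1) (m₁ + 1) (m₂ + 1) (m₃ + 1))) 2 =
      ((i₀ : Fin (m₀ + 1)), (i₁ : Fin (m₁ + 1)), ((i₂ + 1 : ℕ) : Fin (m₂ + 1)), (i₃ : Fin (m₃ + 1))) ∧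
    FinTorusSite.shift ((((i₀ : Fin (m₀ + 1)), (i₁ : Fin (m₁ + 1)), (i₂ : Fin (m₂ + 1)), (i₃ : Fin (m₃ + 1))) :
        FinTorusSite (m₀ + 1) (m₁ + 1) (m₂ + 1) (m₃ + 1))) 3 =
      ((i₀ : Fin (m₀ + 1)), (i₁ : Fin (m₁ + 1)), (i₂ : Fin (m₂ + 1)), ((i₃ + 1 : ℕ) : Fin (m₃ + 1))) := by
  refine ⟨?_, ?_, ?_, ?_⟩ <;>
    simp [FinTorusSite.shift, finRotate_apply, Nat.cast_succ]

/-- The window condition: for `i < m + 1`, `(i : Fin (m+1))` has coordinate `i`. [folklore] -/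
private theorem fh_mod_window {i m : ℕ} (hi : i < m + 1) : i % (m + 1) = i := Nat.mod_eq_of_lt hi

/-- ★ **Holonomy relations of a twisted-flat slab configuration.**  For ANY group `G`, central `zM, zE` and a configuration of the box
`(m₀+1) × (m₁+1) × (m₂+1) × (m₃+1)` all of whose plaquettes of the slab twist `slabTwist zM zE` are trivial, the based Polyakov holonomies
`H₀, H₁, H₂, H₃` through the origin (ordered products of the links along the four axes) satisfy: `H₁H₀H₁⁻¹H₀⁻¹ = zM` (the pair `(H₀, H₁)` EATS
the magnetic twist), `H₃H₂H₃⁻¹H₂⁻¹ = zE`, and the four mixed commutators are trivial. [folklore] -/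
theorem twistedFlat_holonomy_relations {zM zE : G} (hM : zM ∈ Subgroup.center G) (hEc : zE ∈ Subgroup.center G)
    (U : FinTorusSite (m₀ + 1) (m₁ + 1) (m₂ + 1) (m₃ + 1) × Fin 4 → G)
    (hflat : ∀ (x : FinTorusSite (m₀ + 1) (m₁ + 1) (m₂ + 1) (m₃ + 1)) (μ ν : Fin 4), μ < ν →
        tHooftTwistTensor (slabTwist zM zE) x μ ν * finTorusPlaquette U x μ ν = 1) :
    let H0 := lprod (fun i => U (((i : Fin (m₀ + 1)), (0 : Fin (m₁ + 1)), (0 : Fin (m₂ + 1)), (0 : Fin (m₃ + 1))), 0)) (m₀ + 1)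
    let H1 := lprod (fun j => U (((0 : Fin (m₀ + 1)), (j : Fin (m₁ + 1)), (0 : Fin (m₂ + 1)), (0 : Fin (m₃ + 1))), 1)) (m₁ + 1)
    let H2 := lprod (fun j => U (((0 : Fin (m₀ + 1)), (0 : Fin (m₁ + 1)), (j : Fin (m₂ + 1)), (0 : Fin (m₃ + 1))), 2)) (m₂ + 1)
    let H3 := lprod (fun j => U (((0 : Fin (m₀ + 1)), (0 : Fin (m₁ + 1)), (0 : Fin (m₂ + 1)), (j : Fin (m₃ + 1))), 3)) (m₃ + 1)
    H1 * H0 * H1⁻¹ * H0⁻¹ = zM ∧ H3 * H2 * H3⁻¹ * H2⁻¹ = zE ∧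
      H2 * H0 * H2⁻¹ * H0⁻¹ = 1 ∧ H3 * H0 * H3⁻¹ * H0⁻¹ = 1 ∧ H2 * H1 * H2⁻¹ * H1⁻¹ = 1 ∧ H3 * H1 * H3⁻¹ * H1⁻¹ = 1 := by
  intro H0 H1 H2 H3
  have hw : ∀ μ ν, slabTwist zM zE μ ν ∈ Subgroup.center G := fun μ ν => by
    unfold slabTwist
    split_ifs
    · exact hM
    · exact hEc
    · exact Subgroup.one_mem _
  -- generic slice evaluation: `Hν Hμ Hν⁻¹ Hμ⁻¹ = slabTwist zM zE μ ν`
  have hslice : ∀ {μ ν : Fin 4} (_ : μ < ν) {a b : ℕ} (_ : 0 < a) (_ : 0 < b)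
      (emb : ℕ → ℕ → FinTorusSite (m₀ + 1) (m₁ + 1) (m₂ + 1) (m₃ + 1))
      (_ : ∀ i j, (emb i j).shift μ = emb (i + 1) j) (_ : ∀ i j, (emb i j).shift ν = emb i (j + 1))
      (_ : ∀ j, emb a j = emb 0 j) (_ : ∀ i, emb i b = emb i 0)
      (_ : ∀ i j, i < a → j < b →
        ((finTorusSiteCoord (emb i j) μ = 0 ∧ finTorusSiteCoord (emb i j) ν = 0) ↔ (i = 0 ∧ j = 0))),
      lprod (fun j => U (emb 0 j, ν)) b * lprod (fun i => U (emb i 0, μ)) a *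
        (lprod (fun j => U (emb 0 j, ν)) b)⁻¹ * (lprod (fun i => U (emb i 0, μ)) a)⁻¹ = slabTwist zM zE μ ν := by
    intro μ ν hμν a b ha0 hb0 emb hμs hνs ha hb hcoord
    rw [slice_holonomy_comm U hw hflat hμν emb hμs hνs ha hb, lprod_lprod_twist_eq ha0 hb0 emb hcoord, inv_inv]
  -- the six planes through the origin (holonomies `H₀ … H₃` written out; `↑(0:ℕ)` normalised to `0` by `simpa`)
  have h01 : lprod (fun j => U (((0 : Fin (m₀ + 1)), (j : Fin (m₁ + 1)), (0 : Fin (m₂ + 1)), (0 : Fin (m₃ + 1))), 1)) (m₁ + 1) *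
      lprod (fun i => U (((i : Fin (m₀ + 1)), (0 : Fin (m₁ + 1)), (0 : Fin (m₂ + 1)), (0 : Fin (m₃ + 1))), 0)) (m₀ + 1) *
      (lprod (fun j => U (((0 : Fin (m₀ + 1)), (j : Fin (m₁ + 1)), (0 : Fin (m₂ + 1)), (0 : Fin (m₃ + 1))), 1)) (m₁ + 1))⁻¹ *
      (lprod (fun i => U (((i : Fin (m₀ + 1)), (0 : Fin (m₁ + 1)), (0 : Fin (m₂ + 1)), (0 : Fin (m₃ + 1))), 0)) (m₀ + 1))⁻¹ = zM := by
    have h := hslice (μ := 0) (ν := 1) (by decide) (Nat.succ_pos m₀) (Nat.succ_pos m₁)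
      (fun i j : ℕ => ((i : Fin (m₀ + 1)), (j : Fin (m₁ + 1)), ((0 : ℕ) : Fin (m₂ + 1)), ((0 : ℕ) : Fin (m₃ + 1))))
      (fun i j => (fh_shift_cast i j 0 0).1) (fun i j => (fh_shift_cast i j 0 0).2.1)
      (fun j => by simp) (fun i => by simp)
      (fun i j hi hj => by rw [fh_coord_cast]; simp [fh_mod_window hi, fh_mod_window hj])
    simpa [slabTwist] using h
  have h23 : lprod (fun j => U (((0 : Fin (m₀ + 1)), (0 : Fin (m₁ + 1)), (0 : Fin (m₂ + 1)), (j : Fin (m₃ + 1))), 3)) (m₃ + 1) *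
      lprod (fun i => U (((0 : Fin (m₀ + 1)), (0 : Fin (m₁ + 1)), (i : Fin (m₂ + 1)), (0 : Fin (m₃ + 1))), 2)) (m₂ + 1) *
      (lprod (fun j => U (((0 : Fin (m₀ + 1)), (0 : Fin (m₁ + 1)), (0 : Fin (m₂ + 1)), (j : Fin (m₃ + 1))), 3)) (m₃ + 1))⁻¹ *
      (lprod (fun i => U (((0 : Fin (m₀ + 1)), (0 : Fin (m₁ + 1)), (i : Fin (m₂ + 1)), (0 : Fin (m₃ + 1))), 2)) (m₂ + 1))⁻¹ = zE := by
    have h := hslice (μ := 2) (ν := 3) (by decide) (Nat.succ_pos m₂) (Nat.succ_pos m₃)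
      (fun i j : ℕ => (((0 : ℕ) : Fin (m₀ + 1)), ((0 : ℕ) : Fin (m₁ + 1)), (i : Fin (m₂ + 1)), (j : Fin (m₃ + 1))))
      (fun i j => (fh_shift_cast 0 0 i j).2.2.1) (fun i j => (fh_shift_cast 0 0 i j).2.2.2)
      (fun j => by simp) (fun i => by simp)
      (fun i j hi hj => by rw [fh_coord_cast]; simp [fh_mod_window hi, fh_mod_window hj])
    simpa [slabTwist] using h
  have h02 : lprod (fun j => U (((0 : Fin (m₀ + 1)), (0 : Fin (m₁ + 1)), (j : Fin (m₂ + 1)), (0 : Fin (m₃ + 1))), 2)) (m₂ + 1) *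
      lprod (fun i => U (((i : Fin (m₀ + 1)), (0 : Fin (m₁ + 1)), (0 : Fin (m₂ + 1)), (0 : Fin (m₃ + 1))), 0)) (m₀ + 1) *
      (lprod (fun j => U (((0 : Fin (m₀ + 1)), (0 : Fin (m₁ + 1)), (j : Fin (m₂ + 1)), (0 : Fin (m₃ + 1))), 2)) (m₂ + 1))⁻¹ *
      (lprod (fun i => U (((i : Fin (m₀ + 1)), (0 : Fin (m₁ + 1)), (0 : Fin (m₂ + 1)), (0 : Fin (m₃ + 1))), 0)) (m₀ + 1))⁻¹ = 1 := by
    have h := hslice (μ := 0) (ν := 2) (by decide) (Nat.succ_pos m₀) (Nat.succ_pos m₂)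
      (fun i j : ℕ => ((i : Fin (m₀ + 1)), ((0 : ℕ) : Fin (m₁ + 1)), (j : Fin (m₂ + 1)), ((0 : ℕ) : Fin (m₃ + 1))))
      (fun i j => (fh_shift_cast i 0 j 0).1) (fun i j => (fh_shift_cast i 0 j 0).2.2.1)
      (fun j => by simp) (fun i => by simp)
      (fun i j hi hj => by rw [fh_coord_cast]; simp [fh_mod_window hi, fh_mod_window hj])
    simpa [slabTwist] using h
  have h03 : lprod (fun j => U (((0 : Fin (m₀ + 1)), (0 : Fin (m₁ + 1)), (0 : Fin (m₂ + 1)), (j : Fin (m₃ + 1))), 3)) (m₃ + 1) *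
      lprod (fun i => U (((i : Fin (m₀ + 1)), (0 : Fin (m₁ + 1)), (0 : Fin (m₂ + 1)), (0 : Fin (m₃ + 1))), 0)) (m₀ + 1) *
      (lprod (fun j => U (((0 : Fin (m₀ + 1)), (0 : Fin (m₁ + 1)), (0 : Fin (m₂ + 1)), (j : Fin (m₃ + 1))), 3)) (m₃ + 1))⁻¹ *
      (lprod (fun i => U (((i : Fin (m₀ + 1)), (0 : Fin (m₁ + 1)), (0 : Fin (m₂ + 1)), (0 : Fin (m₃ + 1))), 0)) (m₀ + 1))⁻¹ = 1 := by
    have h := hslice (μ := 0) (ν := 3) (by decide) (Nat.succ_pos m₀) (Nat.succ_pos m₃)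
      (fun i j : ℕ => ((i : Fin (m₀ + 1)), ((0 : ℕ) : Fin (m₁ + 1)), ((0 : ℕ) : Fin (m₂ + 1)), (j : Fin (m₃ + 1))))
      (fun i j => (fh_shift_cast i 0 0 j).1) (fun i j => (fh_shift_cast i 0 0 j).2.2.2)
      (fun j => by simp) (fun i => by simp)
      (fun i j hi hj => by rw [fh_coord_cast]; simp [fh_mod_window hi, fh_mod_window hj])
    simpa [slabTwist] using h
  have h12 : lprod (fun j => U (((0 : Fin (m₀ + 1)), (0 : Fin (m₁ + 1)), (j : Fin (m₂ + 1)), (0 : Fin (m₃ + 1))), 2)) (m₂ + 1) *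
      lprod (fun i => U (((0 : Fin (m₀ + 1)), (i : Fin (m₁ + 1)), (0 : Fin (m₂ + 1)), (0 : Fin (m₃ + 1))), 1)) (m₁ + 1) *
      (lprod (fun j => U (((0 : Fin (m₀ + 1)), (0 : Fin (m₁ + 1)), (j : Fin (m₂ + 1)), (0 : Fin (m₃ + 1))), 2)) (m₂ + 1))⁻¹ *
      (lprod (fun i => U (((0 : Fin (m₀ + 1)), (i : Fin (m₁ + 1)), (0 : Fin (m₂ + 1)), (0 : Fin (m₃ + 1))), 1)) (m₁ + 1))⁻¹ = 1 := by
    have h := hslice (μ := 1) (ν := 2) (by decide) (Nat.succ_pos m₁) (Nat.succ_pos m₂)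
      (fun i j : ℕ => (((0 : ℕ) : Fin (m₀ + 1)), (i : Fin (m₁ + 1)), (j : Fin (m₂ + 1)), ((0 : ℕ) : Fin (m₃ + 1))))
      (fun i j => (fh_shift_cast 0 i j 0).2.1) (fun i j => (fh_shift_cast 0 i j 0).2.2.1)
      (fun j => by simp) (fun i => by simp)
      (fun i j hi hj => by rw [fh_coord_cast]; simp [fh_mod_window hi, fh_mod_window hj])
    simpa [slabTwist] using h
  have h13 : lprod (fun j => U (((0 : Fin (m₀ + 1)), (0 : Fin (m₁ + 1)), (0 : Fin (m₂ + 1)), (j : Fin (m₃ + 1))), 3)) (m₃ + 1) *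
      lprod (fun i => U (((0 : Fin (m₀ + 1)), (i : Fin (m₁ + 1)), (0 : Fin (m₂ + 1)), (0 : Fin (m₃ + 1))), 1)) (m₁ + 1) *
      (lprod (fun j => U (((0 : Fin (m₀ + 1)), (0 : Fin (m₁ + 1)), (0 : Fin (m₂ + 1)), (j : Fin (m₃ + 1))), 3)) (m₃ + 1))⁻¹ *
      (lprod (fun i => U (((0 : Fin (m₀ + 1)), (i : Fin (m₁ + 1)), (0 : Fin (m₂ + 1)), (0 : Fin (m₃ + 1))), 1)) (m₁ + 1))⁻¹ = 1 := by
    have h := hslice (μ := 1) (ν := 3) (by decide) (Nat.succ_pos m₁) (Nat.succ_pos m₃)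
      (fun i j : ℕ => (((0 : ℕ) : Fin (m₀ + 1)), (i : Fin (m₁ + 1)), ((0 : ℕ) : Fin (m₂ + 1)), (j : Fin (m₃ + 1))))
      (fun i j => (fh_shift_cast 0 i 0 j).2.1) (fun i j => (fh_shift_cast 0 i 0 j).2.2.2)
      (fun j => by simp) (fun i => by simp)
      (fun i j hi hj => by rw [fh_coord_cast]; simp [fh_mod_window hi, fh_mod_window hj])
    simpa [slabTwist] using h
  exact ⟨h01, h23, h02, h03, h12, h13⟩

/-- ★ **The residual holonomies of a classical vacuum are CENTRAL.**  Under the isolation hypothesis for `zM` (every element commuting with a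
pair of commutator `B A B⁻¹ A⁻¹ = zM` is central — `SU(N)` with `zM` a generator of `Z_N`), every twisted-flat configuration of the slab
`slabTwist zM zE` has `H₂ ∈ Z(G)` and `H₃ ∈ Z(G)`; consequently `zE = 1` (so for `zE ≠ 1` there is none: `no_twistedFlat_slab`), and for the
magnetically twisted slab (`zE = 1`) the long and temporal Polyakov holonomies of EVERY classical vacuum are pinned to the centre — the
twist-eating vacuum has no flat direction. [folklore] -/
theorem twistedFlat_holonomies_central {zM zE : G} (hM : zM ∈ Subgroup.center G) (hEc : zE ∈ Subgroup.center G)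
    (hcent : ∀ A B M : G, B * A * B⁻¹ * A⁻¹ = zM → M * A * M⁻¹ * A⁻¹ = 1 → M * B * M⁻¹ * B⁻¹ = 1 →
      M ∈ Subgroup.center G)
    (U : FinTorusSite (m₀ + 1) (m₁ + 1) (m₂ + 1) (m₃ + 1) × Fin 4 → G)
    (hflat : ∀ (x : FinTorusSite (m₀ + 1) (m₁ + 1) (m₂ + 1) (m₃ + 1)) (μ ν : Fin 4), μ < ν →
        tHooftTwistTensor (slabTwist zM zE) x μ ν * finTorusPlaquette U x μ ν = 1) :
    lprod (fun j => U (((0 : Fin (m₀ + 1)), (0 : Fin (m₁ + 1)), (j : Fin (m₂ + 1)), (0 : Fin (m₃ + 1))), 2)) (m₂ + 1) ∈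
        Subgroup.center G ∧
      lprod (fun j => U (((0 : Fin (m₀ + 1)), (0 : Fin (m₁ + 1)), (0 : Fin (m₂ + 1)), (j : Fin (m₃ + 1))), 3)) (m₃ + 1) ∈
        Subgroup.center G ∧
      zE = 1 := by
  obtain ⟨h01, h23, h02, h03, h12, h13⟩ := twistedFlat_holonomy_relations hM hEc U hflat
  have hH2 := hcent _ _ _ h01 h02 h12
  have hH3 := hcent _ _ _ h01 h03 h13
  refine ⟨hH2, hH3, ?_⟩
  rw [← h23]
  have hc := Subgroup.mem_center_iff.mp hH2
    (lprod (fun j => U (((0 : Fin (m₀ + 1)), (0 : Fin (m₁ + 1)), (0 : Fin (m₂ + 1)), (j : Fin (m₃ + 1))), 3)) (m₃ + 1))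
  rw [hc]; group

end Slab

/-! ## `SU(N)` reading -/

section SpecialUnitary

open Literature.MathematicalPhysics.QuantumLattice

variable {N : ℕ} [NeZero N]

/-- ★ **`SU(N)`: every classical vacuum of the slab with magnetic twist `ω^k·1` (`k` a unit of `ℤ/N`) on `(0,1)` and electric twist `zE` on
`(2,3)` has CENTRE-VALUED long and temporal Polyakov holonomies, and forces `zE = 1`** (twist-eating pair irreducible ⇒ Schur).  The
finite centre `Z_N` is where the line's «residual holonomy `P₂`» lives; the e₂-projection symmetrises over it. [cite: Gonzalezarroyo1998, §4.2] -/
theorem twistedFlat_holonomies_central_specialUnitary {k : ZMod N} (hk : IsUnit k) {zE : Matrix.specialUnitaryGroup (Fin N) ℂ}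
    (hEc : zE ∈ Subgroup.center (Matrix.specialUnitaryGroup (Fin N) ℂ)) {m₀ m₁ m₂ m₃ : ℕ}
    (U : FinTorusSite (m₀ + 1) (m₁ + 1) (m₂ + 1) (m₃ + 1) × Fin 4 → Matrix.specialUnitaryGroup (Fin N) ℂ)
    (hflat : ∀ (x : FinTorusSite (m₀ + 1) (m₁ + 1) (m₂ + 1) (m₃ + 1)) (μ ν : Fin 4), μ < ν →
        tHooftTwistTensor (slabTwist (suCenter N k : Matrix.specialUnitaryGroup (Fin N) ℂ) zE) x μ ν *
          finTorusPlaquette U x μ ν = 1) :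
    lprod (fun j => U (((0 : Fin (m₀ + 1)), (0 : Fin (m₁ + 1)), (j : Fin (m₂ + 1)), (0 : Fin (m₃ + 1))), 2)) (m₂ + 1) ∈
        Subgroup.center (Matrix.specialUnitaryGroup (Fin N) ℂ) ∧
      lprod (fun j => U (((0 : Fin (m₀ + 1)), (0 : Fin (m₁ + 1)), (0 : Fin (m₂ + 1)), (j : Fin (m₃ + 1))), 3)) (m₃ + 1) ∈
        Subgroup.center (Matrix.specialUnitaryGroup (Fin N) ℂ) ∧
      zE = 1 :=
  twistedFlat_holonomies_central (suCenter N k).2 hEc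
    (fun A B M h1 h2 h3 => centralizer_central_of_suCenter hk A B M h1 h2 h3) U hflat

end SpecialUnitary

/-! ## Appendix (append 1): every admissible holonomy datum OCCURS — ladders with central insertions -/

section Realization

variable {G : Type*} [Group G] {m₀ m₁ m₂ m₃ : ℕ}

/-- Shifting in direction `μ` does not change the other coordinates of a `Fin` site. [folklore] -/
private theorem fhr_coord_shift_of_ne (x : FinTorusSite (m₀ + 1) (m₁ + 1) (m₂ + 1) (m₃ + 1)) {μ ν : Fin 4} (h : ν ≠ μ) :
    finTorusSiteCoord (x.shift μ) ν = finTorusSiteCoord x ν := by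
  obtain ⟨a, b, c, d⟩ := x
  fin_cases μ <;> fin_cases ν <;> first | exact absurd rfl h | rfl

/-- ★ **Every admissible long holonomy is realised by a classical vacuum: ladders with a central insertion.**  For a pair eating the
magnetic twist, `Γ₀ Γ₁ Γ₀⁻¹ Γ₁⁻¹ = zM⁻¹`, and ANY central `c₂ ∈ Z(G)`, the configuration with `Γ₀` on the `0`-links of the sheet `x₀ = 0`,
`Γ₁` on the `1`-links of `x₁ = 0`, `c₂` on the `2`-links of `x₂ = 0` (and `1` elsewhere) is twisted-flat for the magnetic slab twist
`slabTwist zM 1`, and its long holonomy `H₂` is `c₂` — so the centre-valued long holonomies allowed by `twistedFlat_holonomies_central` all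
OCCUR ('t Hooft's `N` torelon vacua `Ω₂ ∈ Z_N` of the twisted box, which the e₂-projection averages over `⟨zM⟩`).  NOT here: «holonomies
determine the gauge class» (Fin-box axial gauge). [folklore] -/
theorem ladder_central_twistedFlat {zM Γ₀ Γ₁ c₂ : G} (hΓ : Γ₀ * Γ₁ * Γ₀⁻¹ * Γ₁⁻¹ = zM⁻¹) (hc₂ : c₂ ∈ Subgroup.center G)
    (x : FinTorusSite (m₀ + 1) (m₁ + 1) (m₂ + 1) (m₃ + 1)) {μ ν : Fin 4} (hμν : μ < ν) :
    tHooftTwistTensor (slabTwist zM 1) x μ ν *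
      finTorusPlaquette (fun l : FinTorusSite (m₀ + 1) (m₁ + 1) (m₂ + 1) (m₃ + 1) × Fin 4 =>
        if l.2 = 0 ∧ finTorusSiteCoord l.1 0 = 0 then Γ₀
        else if l.2 = 1 ∧ finTorusSiteCoord l.1 1 = 0 then Γ₁
        else if l.2 = 2 ∧ finTorusSiteCoord l.1 2 = 0 then c₂ else 1) x μ ν = 1 := by
  have hzM : zM * (Γ₀ * (Γ₁ * (Γ₀⁻¹ * Γ₁⁻¹))) = 1 := by
    rw [show Γ₀ * (Γ₁ * (Γ₀⁻¹ * Γ₁⁻¹)) = Γ₀ * Γ₁ * Γ₀⁻¹ * Γ₁⁻¹ by group, hΓ, mul_inv_cancel]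
  -- the central insertion commutes past the twist-eating links
  have hc0 : Γ₀ * (c₂ * (Γ₀⁻¹ * c₂⁻¹)) = 1 := by
    rw [← mul_assoc, Subgroup.mem_center_iff.mp hc₂ Γ₀]; group
  have hc1 : Γ₁ * (c₂ * (Γ₁⁻¹ * c₂⁻¹)) = 1 := by
    rw [← mul_assoc, Subgroup.mem_center_iff.mp hc₂ Γ₁]; group
  unfold tHooftTwistTensor finTorusPlaquette slabTwist
  -- the coordinates of the shifted sites that are read
  have s01 : finTorusSiteCoord (x.shift 0) 1 = finTorusSiteCoord x 1 := fhr_coord_shift_of_ne x (by decide)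
  have s02 : finTorusSiteCoord (x.shift 0) 2 = finTorusSiteCoord x 2 := fhr_coord_shift_of_ne x (by decide)
  have s10 : finTorusSiteCoord (x.shift 1) 0 = finTorusSiteCoord x 0 := fhr_coord_shift_of_ne x (by decide)
  have s12 : finTorusSiteCoord (x.shift 1) 2 = finTorusSiteCoord x 2 := fhr_coord_shift_of_ne x (by decide)
  have s20 : finTorusSiteCoord (x.shift 2) 0 = finTorusSiteCoord x 0 := fhr_coord_shift_of_ne x (by decide)
  have s21 : finTorusSiteCoord (x.shift 2) 1 = finTorusSiteCoord x 1 := fhr_coord_shift_of_ne x (by decide)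
  have s30 : finTorusSiteCoord (x.shift 3) 0 = finTorusSiteCoord x 0 := fhr_coord_shift_of_ne x (by decide)
  have s31 : finTorusSiteCoord (x.shift 3) 1 = finTorusSiteCoord x 1 := fhr_coord_shift_of_ne x (by decide)
  have s32 : finTorusSiteCoord (x.shift 3) 2 = finTorusSiteCoord x 2 := fhr_coord_shift_of_ne x (by decide)
  fin_cases μ <;> fin_cases ν <;> norm_num at hμν <;>
    (by_cases hx0 : finTorusSiteCoord x 0 = 0 <;> by_cases hx1 : finTorusSiteCoord x 1 = 0 <;>
      by_cases hx2 : finTorusSiteCoord x 2 = 0 <;>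
      simp [hx0, hx1, hx2, s01, s02, s10, s12, s20, s21, s30, s31, s32, hzM, hc0, hc1, mul_assoc])

end Realization

end Summit.QuantumFields.YangMills.Cruxes.IRcof.TwistedSlab
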